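import Literature.AlgebraicGeometry.Hu2025.Statements.S04ModelV.R103aModelR
import HarnessLib

/-!
# Hu 2025 (arXiv:2507.21400v1), §4.5 (chunks p0031 l.118 – p0032 l.49; PDF p.73 l.31 – p.75 l.43) — GOVERNING RELATIONS
# (interface I-GOV, row 105, file a `R105aGoverning.lean`): the index sets `Λ_F` (4.38), `𝓑^℘_F` (4.39), `𝓑_[k]` (4.40), the
# leading ϱ-variable (Def. 4.48), governing / non-governing binomials `𝓑^gov_F`, `𝓑^ngv_F` (Def. 4.49–4.50, (4.41)–(4.46)), the
# governing linear relation `L_F` (Def. 4.51; with Def. 4.37's `L_F` itself, on which row 104 aliases), the blocks `𝔊_F` (Def. 4.52)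
# and the identity (4.47). §4.6 (Def. 4.53 divisors, Props 4.54–4.56, chart displays (4.48)–(4.50)) is file b `R105bCharts.lean`
# (one file per printed sub-section; the cut also keeps each file within the statement-only lane's 40 new declarations).
# STATEMENTS-FIRST typing (rung M-Hu-min of LADDER-RESOLUTION, D-0089), filed by the row-105 typer of record res-type-079
# (assignment: the director's 08:00Z «M-Hu-min OPEN» line on the REPOINT LIST of record, res-dag-1 04:27Z; PARTITION-HU §3c.1
# pointer 105 → 079). Provenance: pre-draft bodies v1–v7 by res-type-079 (HOME/plan/tools/res-type-079/hu/README-hu105-IGOV.md;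
# body of record v7 sha16 0f46ff4f39378f7c); T9 LOCATOR AUDIT against BOTH layers (chunk text of record `paper:arxiv-2507.21400`
# p0031/p0032, 1-based line numbers as PARTITION-HU §3 cites them; PDF text `lit/res-lit-6/hu25/text/hu25_p073…p077.txt`):
# every docstring carries «chunk p00cc l.a–b; PDF p.N l.a–b» READ ON BOTH, with the PRINTED equation numbers (4.38)–(4.47)
# (visible only in the PDF layer); locators re-read before filing. Lane-B pre-read note applied before filing: N105-1
# (`Eq4_47` binds `[Finite T]`; res-ref-b12 2026-08-27T06:59Z); T5 siblings added at filing: `Def4_49_equiv_ours` (block-own reading of Def. 4.49's «equivalently»,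
# next to the free-`F` AS-PRINTED rendering `Def4_49_equiv`), `Eq4_46_ours` / `Eq4_47_ours` (the list (4.46) and the count (4.47) read up
# to the sign of a binomial — (4.39) prints both orientations of each pair, so the literal `Bgov` carries `±B_{F,s}`). Carriers = the I-R file `S04ModelV/R103aModelR.lean`
# (row 103; pre-draft res-type-024, filed by res-type-042), imported; nothing of it is re-declared here.

**Status of the source (D-0012): UNREFEREED PREPRINT UNDER ADJUDICATION.** Nothing from the preprint is asserted:
definitions are REAL Lean definitions over Mathlib carriers, printed claims are `def … : Prop` CANDIDATES
`[claim: Hu2025, status: under-review]`. No proofs, no `sorry`, no `instance`, no notation.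

NUMBERING (PARTITION-HU §0 CUSTODY ERRATUM): in §4 the PRINTED (PDF) item number = chunk number + 1 after Def 4.1; decl names
follow the PDF, docstrings carry both («Def. 4.48 ‹chunk Definition 4.47›»). Equation numbers (4.38)–(4.47) are the PDF's (the
chunk layer prints the displays unnumbered).

## Carriers = I-R's (row 103): `{k} [CommRing k] {σ T 𝔗}`, `rel : T → 𝔗` (the `F` of a term), `mono : T → (σ →₀ ℕ)` (chart
monomial `x̄_{u_s} x̄_{v_s}`, `x̄_m = 1`), the ONE ambient ring `ModelRing σ T k = MvPolynomial (σ ⊕ T) k` (= `R`), `rhoVar`,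
`varpiVar`, `wpBinomial mono t t′ = x̄_{t′}·x_t − x̄_t·x_{t′}`, `wpBinomials rel mono Φ` (= `𝓑^℘_Φ` of Def. 4.6; `Φ = {F}` gives `𝓑^℘_F`).
I-GOV reads TWO more data off the primary relations `F̄ = Σ_{s ∈ S_F} sgn(s) x_{u_s} x_{v_s}` ((3.15) chunk p0018 l.48–51; PDF p.37
l.52 – p.38 l.3; row 102's term bookkeeping): `head : 𝔗 → T` (the leading term `s_F` of (3.14), chunk p0018 l.44 «`s_F` is the index for
the leading term of `F`»; so `x_{(m,u_F)} = x_{head F}` and `x̄_{head F} = x_{u_F}`) and `sgn : T → ℤ`. «A binomial contains a variable» =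
membership in `MvPolynomial.vars`. The 𝔯𝔟-binomials `𝓑^𝔯𝔟_Φ` (Def. 4.32 ‹4.31›, row 104) enter as a PARAMETER `Brb`.
-/

noncomputable section

namespace Literature.AlgebraicGeometry.Hu2025.Statements.S04ModelV

open MvPolynomial

universe u v w x

section Governing

variable {k : Type u} [CommRing k] {σ : Type v} {T : Type w} {𝔗 : Type x}
variable (rel : T → 𝔗) (mono : T → (σ →₀ ℕ)) (head : 𝔗 → T) (sgn : T → ℤ)

/-! ## Def. 4.37 `L_F` (row 104 — minimal rendering I-GOV rides on; row 104's `Def4_37` is an ALIAS of this decl by agreement,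
res-type-044 README-hu104 2026-08-27T03:49Z) -/

/-- **Hu 2025, Def. 4.37 ‹chunk Definition 4.36›, the linearized Plücker relation `L_F : Σ_{s ∈ S_F} sgn(s) x_{(u_s,v_s)}`** (chunk p0029
l.32–38; PDF p.66 l.32–39), verbatim: «Given any `F̄ ∈ 𝓕`, written as `F̄ = Σ_{s ∈ S_F} sgn(s) x_{u_s}x_{v_s}`, we introduce
`L_F : Σ_{s ∈ S_F} sgn(s) x_{(u_s,v_s)}`. This is called the linearized Plücker relation with respect to `F̄` (or `F`).» — the signed sum
of the ϱ-variables of the block `F`, over a finite term type. [claim: Hu2025, status: under-review]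
STATUS: candidate statement under adjudication (D-0012/D-0089); not asserted. -/
def linPl [Fintype T] [DecidableEq 𝔗] (F : 𝔗) : ModelRing σ T k :=
  ∑ t ∈ Finset.univ.filter (fun t => rel t = F), (sgn t : ModelRing σ T k) * rhoVar t

/-! ## §4.5.1 «We begin with setting and recalling some notations» (chunk p0031 l.122–154; PDF p.73 l.32 – p.74 l.11) -/

/-- **Hu 2025, (4.38), `Λ_F`** (chunk p0031 l.124–130; PDF p.73 l.32–35), verbatim: «For any `F̄ ∈ 𝓕`, we let
`Λ_F = {(u_s, v_s) ∣ s ∈ S_F}`. This is an index set for all the homogeneous coordinates in `ℙ_F`.» — in I-R's carriers the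
homogeneous coordinates of `ℙ_F` are indexed by the TERMS of `F`: `Λ_F = {t : T ∣ rel t = F}`. [claim: Hu2025, status: under-review]
STATUS: candidate statement under adjudication (D-0012/D-0089); not asserted. -/
def LambdaF (F : 𝔗) : Set T := {t | rel t = F}

/-- **Hu 2025, (4.38)** — numbered alias of `LambdaF`. [claim: Hu2025, status: under-review]
STATUS: candidate statement under adjudication (D-0012/D-0089); not asserted. -/
abbrev Eq4_38 (F : 𝔗) : Set T := LambdaF rel F

/-- **Hu 2025, `Λ_𝓕 = ⊔_{F̄ ∈ 𝓕} Λ_F`** (chunk p0031 l.131–133; PDF p.73 l.35–36: «For later use, we also set `Λ_𝓕 = ⊔_{F̄ ∈ 𝓕} Λ_F`.»)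
— all terms. [claim: Hu2025, status: under-review]
STATUS: candidate statement under adjudication (D-0012/D-0089); not asserted. -/
def LambdaAll : Set T := ⋃ F : 𝔗, LambdaF rel F

/-- **Hu 2025, (4.39), `𝓑^℘_F` AS PRINTED** (chunk p0031 l.135–140; PDF p.73 l.37–40), verbatim: «For any `F̄ ∈ 𝓕`, we let
`𝓑^℘_F = {x_{u′} x_{v′} x_{(u,v)} − x_u x_v x_{(u′,v′)} ∣ (u,v), (u′,v′) ∈ Λ_F}`» — the set of the (4.8)-binomials of ALL pairs of terms
of `F`, the zero binomial of a pair `(u,v) = (u′,v′)` included. -- sic: Def. 4.6 (chunk «Definition 4.5» p0022 l.23–27; PDF p.47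
l.23–24) defines the ℘-binomials as the NONZERO such binomials; see `Eq4_39_ours`. [claim: Hu2025, status: under-review]
STATUS: candidate statement under adjudication (D-0012/D-0089); not asserted. -/
def Eq4_39 (F : 𝔗) : Set (ModelRing σ T k) :=
  {b | ∃ t t' : T, rel t = F ∧ rel t' = F ∧ b = wpBinomial (k := k) mono t t'}

/-- **`𝓑^℘_F` OURS** (the evident reading of (4.39) consistent with Def. 4.6): I-R's `wpBinomials rel mono {F}` — the nonzero
(4.8)-binomials of two distinct terms of the block `F`. Every later decl of this file uses THIS set for `𝓑^℘_F`.
[claim: Hu2025, status: under-review]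
STATUS: candidate statement under adjudication (D-0012/D-0089); not asserted. -/
abbrev Eq4_39_ours (F : 𝔗) : Set (ModelRing σ T k) := wpBinomials (k := k) rel mono {F}

/-- **Hu 2025, chunk p0031 l.142–144; PDF p.73 l.41–46**, verbatim: «Thus, we have `𝓑^℘ = ⋃_{F̄ ∈ 𝓕} 𝓑^℘_F`.» — typed claim for I-R's
`𝓑^℘ = wpBinomials rel mono univ` (Def. 4.6 at `k = Υ`). [claim: Hu2025, status: under-review]
STATUS: candidate statement under adjudication (D-0012/D-0089); not asserted. -/
def C31L142 (rel : T → 𝔗) (mono : T → (σ →₀ ℕ)) : Prop :=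
  wpBinomials (k := k) rel mono Set.univ = ⋃ F : 𝔗, wpBinomials (k := k) rel mono {F}

/-- **Hu 2025, (4.40), `𝓑_{[k]} = 𝓑^℘_{[k]} ⊔ 𝓑^𝔯𝔟_{[k]}`** (chunk p0031 l.146–150; PDF p.74 l.3–7), verbatim: «Further, we set
`𝓑_{[k]} = 𝓑^℘_{[k]} ⊔ 𝓑^𝔯𝔟_{[k]}`.»; «When `k = Υ`, we write `𝓑 = 𝓑^℘_{[Υ]} ⊔ 𝓑^𝔯𝔟_{[Υ]}`» (chunk l.152–154; PDF p.74 l.8–11) — over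
an explicit set `Φ ⊆ 𝓕` of relations (`Φ = 𝓕_[k]` is row 102's order; `Φ = univ` gives `𝓑`), with row 104's `𝓑^𝔯𝔟_Φ` (Def. 4.32) as
the PARAMETER `Brb`. [claim: Hu2025, status: under-review]
STATUS: candidate statement under adjudication (D-0012/D-0089); not asserted. -/
def BIn (Brb : Set (ModelRing σ T k)) (Φ : Set 𝔗) : Set (ModelRing σ T k) :=
  wpBinomials (k := k) rel mono Φ ∪ Brb

/-- **Hu 2025, (4.40)** — numbered alias of `BIn`. [claim: Hu2025, status: under-review]
STATUS: candidate statement under adjudication (D-0012/D-0089); not asserted. -/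
abbrev Eq4_40 (Brb : Set (ModelRing σ T k)) (Φ : Set 𝔗) : Set (ModelRing σ T k) := BIn (k := k) rel mono Brb Φ

/-! ## §4.5.2 Governing binomial relations (chunk p0031 l.156 – p0032 l.49; PDF p.74 l.12 – p.75 l.43) -/

/-- **Hu 2025, Def. 4.48 ‹chunk Definition 4.47›** (chunk p0031 l.162–163; PDF p.74 l.14), verbatim: «We call `x_{((123), u_F)}` the
leading ϱ-variable for any `F̄ ∈ 𝓕`.» — the ϱ-variable of the leading term `s_F = head F` of `F` (preceded by chunk l.158–160; PDF
p.74 l.12–13: «recall from (3.15), `u_F` is the index for the leading variable `x_{u_F}` of the primary Plücker relation `F̄`»).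
[claim: Hu2025, status: under-review]
STATUS: candidate statement under adjudication (D-0012/D-0089); not asserted. -/
def leadingRhoVar (F : 𝔗) : ModelRing σ T k := rhoVar (head F)

/-- **Hu 2025, Def. 4.48** — numbered alias of `leadingRhoVar`. [claim: Hu2025, status: under-review]
STATUS: candidate statement under adjudication (D-0012/D-0089); not asserted. -/
abbrev Def4_48 (F : 𝔗) : ModelRing σ T k := leadingRhoVar (k := k) (σ := σ) head F

/-- «`f` contains a leading ϱ-variable» (Def. 4.49's first clause, chunk p0031 l.166; PDF p.74 l.15–16): some `x_{head F}` occurs in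
`f` (Mathlib `MvPolynomial.vars`). Plumbing predicate. [claim: Hu2025, status: under-review]
STATUS: candidate statement under adjudication (D-0012/D-0089); not asserted. -/
def ContainsLeadingRhoVar (f : ModelRing σ T k) : Prop := ∃ F : 𝔗, (Sum.inr (head F) : σ ⊕ T) ∈ f.vars

/-- «`f` contains a leading ϖ-variable `x_{u_F}`» (Def. 4.49's second clause, chunk p0031 l.166; PDF p.74 l.16; the leading
variable `x_{u_F} := x_{u_{s_F}}` of (3.15), chunk p0018 l.53; PDF p.38 l.3): some `x_s` with `x̄_{head F} = x_s` (i.e.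
`mono (head F) = 𝟙_s`) occurs in `f`. Plumbing predicate. [claim: Hu2025, status: under-review]
STATUS: candidate statement under adjudication (D-0012/D-0089); not asserted. -/
def ContainsLeadingVarpiVar (f : ModelRing σ T k) : Prop :=
  ∃ (F : 𝔗) (s : σ), mono (head F) = Finsupp.single s 1 ∧ (Sum.inl s : σ ⊕ T) ∈ f.vars

/-- **Hu 2025, Def. 4.49 ‹chunk Definition 4.48›** (chunk p0031 l.165–166; PDF p.74 l.15–16), verbatim: «A binomial relations [sic] of
`𝓑^℘` is said to be governing if it contains a leading ϱ-variable, equivalently it contains a leading ϖ-variable.» — typed by the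
FIRST clause; the «equivalently» is the claim `Def4_49_equiv`. [claim: Hu2025, status: under-review]
STATUS: candidate statement under adjudication (D-0012/D-0089); not asserted. -/
def IsGoverning (f : ModelRing σ T k) : Prop := ContainsLeadingRhoVar (k := k) (σ := σ) head f

/-- **Hu 2025, Def. 4.49** — numbered alias of `IsGoverning`. [claim: Hu2025, status: under-review]
STATUS: candidate statement under adjudication (D-0012/D-0089); not asserted. -/
abbrev Def4_49 (f : ModelRing σ T k) : Prop := IsGoverning (k := k) (σ := σ) head f

/-- **Hu 2025, Def. 4.49, «equivalently»** (chunk p0031 l.166; PDF p.74 l.16): for every binomial of `𝓑^℘` (all blocks, `Φ = univ`),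
«contains a leading ϱ-variable» ⇔ «contains a leading ϖ-variable». Typed claim. [claim: Hu2025, status: under-review]
STATUS: candidate statement under adjudication (D-0012/D-0089); not asserted. -/
def Def4_49_equiv (rel : T → 𝔗) (mono : T → (σ →₀ ℕ)) (head : 𝔗 → T) : Prop :=
  ∀ f : ModelRing σ T k, f ∈ wpBinomials (k := k) rel mono Set.univ →
    (IsGoverning (k := k) (σ := σ) head f ↔ ContainsLeadingVarpiVar (k := k) mono head f)

/-- **Def. 4.49, «equivalently» — OURS (block-own reading; T5 sibling of `Def4_49_equiv`).** The printed clause (chunk p0031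
l.166; PDF p.74 l.16) does not say of WHICH `F̄` the leading ϱ- or ϖ-variable is; `Def4_49_equiv` renders both sides with a free
`F′ ∈ 𝓕` (AS PRINTED, literally), this sibling renders both for the binomial's OWN block: for `f ∈ 𝓑^℘_F`, «`f` contains
`x_{((123),u_F)}`» ⇔ «`f` contains `x_{u_F}`» (the leading ϖ-variable `x_{u_F} = x̄_{head F}` of the SAME `F̄`, when that chart
monomial is a single variable, as on the platform where `x̄_m = 1`). The two renderings differ exactly when a ϖ-variable `x_{u_{F′}}`,
`F′ ≠ F`, divides a chart monomial of a term of `F` (at the platform `Gr^{3,E}`, `n ≥ 6`, e.g. the term `x_{124}x_{356}` of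
`F̄_{(123),(456)}` carries `x_{356} = x_{u_{F′}}`, `F′ = F̄_{(123),(356)}`); the lanes read BOTH; no side is taken here.
[claim: Hu2025, status: under-review]
STATUS: candidate statement under adjudication (D-0012/D-0089); not asserted. -/
def Def4_49_equiv_ours (rel : T → 𝔗) (mono : T → (σ →₀ ℕ)) (head : 𝔗 → T) : Prop :=
  ∀ (F : 𝔗) (f : ModelRing σ T k), f ∈ wpBinomials (k := k) rel mono {F} →
    ((Sum.inr (head F) : σ ⊕ T) ∈ f.vars ↔
      ∃ s : σ, mono (head F) = Finsupp.single s 1 ∧ (Sum.inl s : σ ⊕ T) ∈ f.vars)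

/-- **Hu 2025, Def. 4.50 ‹chunk Definition 4.49›, `𝓑^gov_F`** (chunk p0031 l.168–172; PDF p.74 l.17–22), verbatim: «Fix any `F̄ ∈ 𝓕`. We
let `𝓑^gov_F` be the set of governing binomials of `𝓑^℘_F` that contains the leading ϱ-variable `x_{((123), u_F)}`. These are called
governing binomials with respect to `F̄`.» — LITERAL filter of `𝓑^℘_F = wpBinomials rel mono {F}` (`Eq4_39_ours`).
[claim: Hu2025, status: under-review]
STATUS: candidate statement under adjudication (D-0012/D-0089); not asserted. -/
def Bgov (F : 𝔗) : Set (ModelRing σ T k) :=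
  {f | f ∈ wpBinomials (k := k) rel mono {F} ∧ IsGoverning (k := k) (σ := σ) head f ∧
    (Sum.inr (head F) : σ ⊕ T) ∈ f.vars}

/-- **Hu 2025, Def. 4.50, `𝓑^ngv_F`** (chunk p0031 l.172–173; PDF p.74 l.22–28), verbatim: «We set `𝓑^ngv_F = 𝓑_F ∖ 𝓑^gov_F`. The
binomials of `𝓑^ngv_F` are called non-governing binomials with respect to `F̄`.» — `𝓑_F` (a symbol the text does not define) read as
`𝓑^℘_F`, the reading (4.44) `𝓑^ngv_{[k]} = 𝓑^℘_{[k]} ∖ 𝓑^gov_{[k]}` confirms. [claim: Hu2025, status: under-review]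
STATUS: candidate statement under adjudication (D-0012/D-0089); not asserted. -/
def Bngv (F : 𝔗) : Set (ModelRing σ T k) :=
  wpBinomials (k := k) rel mono {F} \ Bgov (k := k) rel mono head F

/-- **Hu 2025, Def. 4.50** — numbered alias: the pair (`𝓑^gov_F`, `𝓑^ngv_F`). [claim: Hu2025, status: under-review]
STATUS: candidate statement under adjudication (D-0012/D-0089); not asserted. -/
abbrev Def4_50 (F : 𝔗) : Set (ModelRing σ T k) × Set (ModelRing σ T k) :=
  (Bgov (k := k) rel mono head F, Bngv (k := k) rel mono head F)

/-- **Hu 2025, (4.41), the governing binomial `B_{F,s}`** (chunk p0031 l.175–181; PDF p.74 l.29–33), verbatim: «Typically in a proof we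
write governing binomials of `𝓑^gov_F` as `B_{F,s} : x_{(u_s,v_s)} x_{u_F} − x_{(m,u_F)} x_{u_s} x_{v_s}`, `s ∈ S_F ∖ s_F`» = the (4.8)
binomial of the pair `(s, s_F)`: `x̄_{s_F}·x_s − x̄_s·x_{s_F}` with `x̄_{s_F} = x_m x_{u_F} = x_{u_F}`. [claim: Hu2025, status: under-review]
STATUS: candidate statement under adjudication (D-0012/D-0089); not asserted. -/
def govBinomial (F : 𝔗) (s : T) : ModelRing σ T k := wpBinomial mono s (head F)

/-- **Hu 2025, (4.41)** — numbered alias of `govBinomial`. [claim: Hu2025, status: under-review]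
STATUS: candidate statement under adjudication (D-0012/D-0089); not asserted. -/
abbrev Eq4_41 (F : 𝔗) (s : T) : ModelRing σ T k := govBinomial (k := k) mono head F s

/-- **Hu 2025, (4.42), the non-governing binomial `B_{F,(s,t)}` AS PRINTED** (chunk p0031 l.183–189; PDF p.74 l.34–38), verbatim:
«and we write non-governing binomials of `𝓑^ngv_F` as `B_{F,(s,t)} : x_{(u_s,v_s)} x_{u_t} x_{v_t} − x_{(u_t,v_t)} x_{u_t} x_{u_s} x_{v_s}`,
`s, t ∈ S_F ∖ s_F`» — the second term carries an EXTRA factor `x_{u_t}` in print (both layers). -- sic (the `𝓑^℘` pattern of (4.39),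
chunk p0031 l.138–139, and the chart display (4.50), chunk p0033 l.2–3; PDF p.77 l.32–33, read `x_{(u_t,v_t)} x_{u_s} x_{v_s}`). Typed AS
PRINTED with the stray factor supplied as an explicit ϖ-index `ut` (the single variable `x_{u_t}` is not recoverable from
`mono t = x̄_{u_t} x̄_{v_t}`); see `ngvBinomial_ours`. [claim: Hu2025, status: under-review]
STATUS: candidate statement under adjudication (D-0012/D-0089); not asserted. -/
def ngvBinomial (s t : T) (ut : σ) : ModelRing σ T k :=
  toModel (img mono t) * rhoVar s - toModel (img mono s) * varpiVar ut * rhoVar t -- sic: stray x_{u_t}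

/-- **Hu 2025, (4.42)** — numbered alias of `ngvBinomial` (AS PRINTED). [claim: Hu2025, status: under-review]
STATUS: candidate statement under adjudication (D-0012/D-0089); not asserted. -/
abbrev Eq4_42 (s t : T) (ut : σ) : ModelRing σ T k := ngvBinomial (k := k) mono s t ut

/-- **`B_{F,(s,t)}` OURS** (evident correction of (4.42): drop the stray `x_{u_t}`) = the (4.8) binomial of the pair `(s,t)`,
`s, t ≠ s_F`: `x̄_t·x_s − x̄_s·x_t`. [claim: Hu2025, status: under-review]
STATUS: candidate statement under adjudication (D-0012/D-0089); not asserted. -/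
def ngvBinomial_ours (s t : T) : ModelRing σ T k := wpBinomial mono s t

/-- **Hu 2025, (4.43), `𝓑^gov_{[k]} = ⊔_{i ∈ [k]} 𝓑^gov_{F_i}`** (chunk p0031 l.191–195; PDF p.74 l.39–43), and «`𝓑^gov = 𝓑^gov_{[Υ]}`»
(chunk l.202–204; PDF p.74 l.50–54) — over an explicit set `Φ ⊆ 𝓕` of relations (`Φ = 𝓕_[k]` is row 102's order; `Φ = univ` gives
`𝓑^gov`). [claim: Hu2025, status: under-review]
STATUS: candidate statement under adjudication (D-0012/D-0089); not asserted. -/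
def BgovIn (Φ : Set 𝔗) : Set (ModelRing σ T k) := ⋃ F ∈ Φ, Bgov (k := k) rel mono head F

/-- **Hu 2025, (4.43)** — numbered alias of `BgovIn`. [claim: Hu2025, status: under-review]
STATUS: candidate statement under adjudication (D-0012/D-0089); not asserted. -/
abbrev Eq4_43 (Φ : Set 𝔗) : Set (ModelRing σ T k) := BgovIn (k := k) rel mono head Φ

/-- **Hu 2025, (4.44), `𝓑^ngv_{[k]} = 𝓑^℘_{[k]} ∖ 𝓑^gov_{[k]}`** (chunk p0031 l.197–200; PDF p.74 l.44–49), and «`𝓑^ngv = 𝓑^ngv_{[Υ]}`»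
(chunk l.202–204; PDF p.74 l.50–54). [claim: Hu2025, status: under-review]
STATUS: candidate statement under adjudication (D-0012/D-0089); not asserted. -/
def BngvIn (Φ : Set 𝔗) : Set (ModelRing σ T k) :=
  wpBinomials (k := k) rel mono Φ \ BgovIn (k := k) rel mono head Φ

/-- **Hu 2025, (4.44)** — numbered alias of `BngvIn`. [claim: Hu2025, status: under-review]
STATUS: candidate statement under adjudication (D-0012/D-0089); not asserted. -/
abbrev Eq4_44 (Φ : Set 𝔗) : Set (ModelRing σ T k) := BngvIn (k := k) rel mono head Φ

/-- **Hu 2025, (4.45)** (chunk p0031 l.206 – p0032 l.3; PDF p.74 l.55–57), verbatim: «Then, we have `𝓑 = 𝓑^gov ⊔ 𝓑^ngv ⊔ 𝓑^𝔯𝔟`.» — typed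
as the set identity for `𝓑 = BIn Brb univ` of (4.40), `𝓑^𝔯𝔟 = Brb` the parameter (row 104's Def. 4.32); the disjointness the symbol
`⊔` suggests is not typed. Typed claim. [claim: Hu2025, status: under-review]
STATUS: candidate statement under adjudication (D-0012/D-0089); not asserted. -/
def Eq4_45 (rel : T → 𝔗) (mono : T → (σ →₀ ℕ)) (head : 𝔗 → T) (Brb : Set (ModelRing σ T k)) : Prop :=
  BIn (k := k) rel mono Brb Set.univ =
    BgovIn (k := k) rel mono head Set.univ ∪ BngvIn (k := k) rel mono head Set.univ ∪ Brb

/-- **Hu 2025, chunk p0032 l.5–7; PDF p.75 l.3–5**, verbatim: «Although a binomial of `𝓑^𝔯𝔟` is also non-governing, we usually refers [sic]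
it as 𝔯𝔟-binomial (it is of ϱ-degree 2 or higher), and by a non-governing binomial, we mean a binomial of `𝓑^ngv` (it is always of
ϱ-degree 1).» — the `𝓑^𝔯𝔟` clause concerns row 104's Def. 4.32; typed here is only the in-text claim «every binomial of `𝓑^ngv` is
ϱ-linear» (I-R's `IsRhoLinear`). (v5 name `C32L4`; renamed to the line where the sentence starts.) [claim: Hu2025, status: under-review]
STATUS: candidate statement under adjudication (D-0012/D-0089); not asserted. -/
def C32L5 [DecidableEq 𝔗] (rel : T → 𝔗) (mono : T → (σ →₀ ℕ)) (head : 𝔗 → T) : Prop :=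
  ∀ f : ModelRing σ T k, f ∈ BngvIn (k := k) rel mono head Set.univ → IsRhoLinear (k := k) (σ := σ) rel f

/-- **Hu 2025, (4.46)** (chunk p0032 l.9–24; PDF p.75 l.6–15): «In concrete terms, all the governing binomials are classified as follows»
— nine printed families (`u < v ∈ [n] ∖ [3]`, `a < b < c ∈ [n] ∖ [3]`), e.g. «`x_{1uv} x_{(12u,13v)} − x_{12u} x_{13v} x_{(123,1uv)}`»; the
sixth entry reads «`x_{3uv} x_{(23u,13v)} − x_{23u} x_{12v} x_{(123,3uv)}`» (chunk l.16; PDF p.75 l.11) -- sic (pattern: `x_{23u} x_{13v}`);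
«We see that the terms of all the primary Plücker relations are separated into the two terms of the above binomials.» Typed as the
CLAIM `𝓑^gov_F = {B_{F,s} : s ∈ S_F ∖ s_F}` — what (4.41) «we write governing binomials of `𝓑^gov_F` as `B_{F,s}`» and the list (4.46)
assert at the platform (the families are what `govBinomial` enumerates at `σ = plVar n`). READING NOTE: (4.39) prints `𝓑^℘_F` with
BOTH orientations of each pair of terms (the roles of `(u,v)`, `(u′,v′)` are symmetric), and so does I-R's `wpBinomials`; hence the
literal `𝓑^gov_F` (`Bgov`) contains `B_{F,s}` together with `−B_{F,s} = B_{(head F, s)}`-oriented, while the display lists one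
orientation per `s` — this decl is the LITERAL equality (AS PRINTED); the sibling `Eq4_46_ours` reads the list up to sign. (v5 name
`C32L9`.) [claim: Hu2025, status: under-review]
STATUS: candidate statement under adjudication (D-0012/D-0089); not asserted. -/
def Eq4_46 (rel : T → 𝔗) (mono : T → (σ →₀ ℕ)) (head : 𝔗 → T) : Prop :=
  ∀ F : 𝔗, Bgov (k := k) rel mono head F =
    {f | ∃ s : T, rel s = F ∧ s ≠ head F ∧ f = govBinomial (k := k) mono head F s}

/-- **(4.46) — OURS (up to sign; T5 sibling of `Eq4_46`)**: `𝓑^gov_F = {±B_{F,s} : s ∈ S_F ∖ s_F}` — the governing binomials of the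
block `F` are the binomials `B_{F,s}` of (4.41) in either orientation (the orientation `(head F, s)` of a pair in (4.39) gives `−B_{F,s}`).
[claim: Hu2025, status: under-review]
STATUS: candidate statement under adjudication (D-0012/D-0089); not asserted. -/
def Eq4_46_ours (rel : T → 𝔗) (mono : T → (σ →₀ ℕ)) (head : 𝔗 → T) : Prop :=
  ∀ F : 𝔗, Bgov (k := k) rel mono head F =
    {f | ∃ s : T, rel s = F ∧ s ≠ head F ∧
      (f = govBinomial (k := k) mono head F s ∨ f = -govBinomial (k := k) mono head F s)}

/-- **Hu 2025, Def. 4.51 ‹chunk Definition 4.50›** (chunk p0032 l.26–28; PDF p.75 l.16–17), verbatim: «We also call the linearized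
Plücker relation `L_F` a governing relation for any `F̄ ∈ 𝓕`.» — terminology: the governing LINEAR relation of `F` is `linPl … F`.
[claim: Hu2025, status: under-review]
STATUS: candidate statement under adjudication (D-0012/D-0089); not asserted. -/
abbrev Def4_51 [Fintype T] [DecidableEq 𝔗] (F : 𝔗) : ModelRing σ T k := linPl (k := k) (σ := σ) rel sgn F

/-- **Hu 2025, Def. 4.52 ‹chunk Definition 4.51›, the block `𝔊_F`** (chunk p0032 l.30–31; PDF p.75 l.18–21), verbatim: «Given any
`F̄ ∈ 𝓕`, we let `𝔊_F = 𝓑^gov_F ⊔ {L_F}`. We call it the block of governing relations with respect to `F`.»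
[claim: Hu2025, status: under-review]
STATUS: candidate statement under adjudication (D-0012/D-0089); not asserted. -/
def blockG [Fintype T] [DecidableEq 𝔗] (F : 𝔗) : Set (ModelRing σ T k) :=
  Bgov (k := k) rel mono head F ∪ {linPl (k := k) (σ := σ) rel sgn F}

/-- **Hu 2025, Def. 4.52** — numbered alias of `blockG`. [claim: Hu2025, status: under-review]
STATUS: candidate statement under adjudication (D-0012/D-0089); not asserted. -/
abbrev Def4_52 [Fintype T] [DecidableEq 𝔗] (F : 𝔗) : Set (ModelRing σ T k) := blockG (k := k) rel mono head sgn F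

/-- **Hu 2025, Def. 4.52, `𝔊 = ⊔_{F̄ ∈ 𝓕} 𝔊_F`** (chunk p0032 l.33–35; PDF p.75 l.22–26); «Note that the set `𝔊` is totally ordered:
`𝔊_{F_1} < ⋯ < 𝔊_{F_Υ}`» (chunk l.37–39; PDF p.75 l.27–28; the block order = Def. 3.15, row 102; not re-typed).
[claim: Hu2025, status: under-review]
STATUS: candidate statement under adjudication (D-0012/D-0089); not asserted. -/
def blockGAll [Fintype T] [DecidableEq 𝔗] : Set (ModelRing σ T k) := ⋃ F : 𝔗, blockG (k := k) rel mono head sgn F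

/-- **Hu 2025, (4.47)** (chunk p0032 l.41–49; PDF p.75 l.29–43), verbatim: «We observe here that
`dim (Π_{F̄ ∈ 𝓕} ℙ_F) = Σ_{F̄ ∈ 𝓕} |S_F ∖ s_F| = Σ_{F̄ ∈ 𝓕} |𝓑^gov_F| = |𝓑^gov|`, where `|K|` denotes the cardinality of a finite set `K`.
This is an important identity — not accidental, even if it may seem so» (the sentence ends without a full stop in both layers).
Typed per block: `|𝓑^gov_F| = |S_F| − 1` (`= |S_F ∖ s_F| = dim ℙ_F`), over a FINITE term type `T` (the printed sets are finite; with
`Nat.card` on an infinite `T` both sides would read `0`). (v5 name `C32L36`; v7: `[Finite T]` binder, lane-B pre-read note N105-1.)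
[claim: Hu2025, status: under-review]
STATUS: candidate statement under adjudication (D-0012/D-0089); not asserted. -/
def Eq4_47 [Finite T] (rel : T → 𝔗) (mono : T → (σ →₀ ℕ)) (head : 𝔗 → T) : Prop :=
  ∀ F : 𝔗, Nat.card (Bgov (k := k) rel mono head F) = Nat.card {t : T // rel t = F} - 1

/-- **(4.47) — OURS (counting the printed list; T5 sibling of `Eq4_47`)**: `|{B_{F,s} : s ∈ S_F ∖ s_F}| = |S_F| − 1`, i.e. the
governing binomials `B_{F,s}` of (4.41), one per non-leading term `s` of `F`, are pairwise distinct — the count behind «`dim ℙ_F =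
|S_F ∖ s_F| = |𝓑^gov_F|`» when `𝓑^gov_F` is the printed LIST (4.46); the literal `Bgov` of `Eq4_47` counts both orientations of (4.39)
(READING NOTE at `Eq4_46`). Over a finite term type. [claim: Hu2025, status: under-review]
STATUS: candidate statement under adjudication (D-0012/D-0089); not asserted. -/
def Eq4_47_ours [Finite T] (rel : T → 𝔗) (mono : T → (σ →₀ ℕ)) (head : 𝔗 → T) : Prop :=
  ∀ F : 𝔗, Nat.card {f : ModelRing σ T k | ∃ s : T, rel s = F ∧ s ≠ head F ∧ f = govBinomial (k := k) mono head F s} =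
    Nat.card {t : T // rel t = F} - 1

end Governing

end Literature.AlgebraicGeometry.Hu2025.Statements.S04ModelV

end
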